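import Summits.KontsevichZagierPeriods.KontsevichZagierPeriods.Theses.HurwitzMicroSectors
import Summits.KontsevichZagierPeriods.KontsevichZagierPeriods.Theorems.HurwitzMicroSectorsNormalFormPrinciplePiBoxTransfer
import Summits.KontsevichZagierPeriods.KontsevichZagierPeriods.Theorems.HurwitzMicroSectorsNormalFormPrincipleBoxRigidityDimOne

/-! TTRL-lite variant V2340 of stmt-KontsevichZagierPeriods-3869

Variant V2340 = `stub_boxRigidity` (BoxRigidity: two representations on open unit boxes with integrands
of KZ's rational shape and equal values are KZ-equivalent) under the TWO-sided small-case move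
`bound_nat:m≤3; bound_nat:m'≤2`. Verdict of the attempt seat: **open** — this file is the certificate
(what the variant is exactly worth), not a proof of the variant. Unlike the one-sided bounds (files
`…Variants2200/2256`: one frozen or bounded dimension is already the whole leaf), a JOINT bound does
weaken the stub, and exactly to a dimension-bounded vanishing statement: for all `j, k`,
`BoxRigidity(m ≤ j, m' ≤ k) ⟺ BoxVanishing(dim ≤ max j k)` (`boxRigidityLe_iff_boxVanishingLe`:
`⇒` compare with the zero representation on the `0`-box from the unbounded-enough side; `⇐` pad both
representations to the common dimension `max m m' ≤ max j k` by unit intervals (`pad_le`), subtract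
on the common box (`sub_same`), the difference has value `0` by soundness). Hence
`V2340 ⟺ BoxVanishing(dim ≤ 3) ⟺ BoxRigidity(m, m' ≤ 3)` (`stub_boxRigidity_var2340_iff_boxVanishingLe`,
`stub_boxRigidity_var2340_iff_le_three`): the bound on `m'` is idle, the variant is symmetric, and it
contains Conjecture 1 for ALL rational functions over `ℚ` on `(0,1)²` and `(0,1)³` — every `ℚ`-linear
relation among `ζ(2)`, `ζ(3)`, Catalan's `G`, `π log 2`, `log² 2`, … would have to be produced by
moves, and no transcendence input of that strength exists (the tree's own dimension-two layers,
`boxRigidity_levelTwo`, `boxRigidity_levelOne_le_three`, are conditional on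
`LinearIndependent ℚ ![1, π², log 2]`, resp. `![1, π², ζ(3)]`, both open). The proved frontier is
`BoxVanishing(dim ≤ 1)` (`boxVanishingLe_one`, from `boxRigidity_of_le_one`, Baker), i.e. exactly the
two-sided variants with `max j k ≤ 1` (`boxRigidityLe_of_max_le_one`). On the other side
`KontsevichZagierPeriods → V2340` (`stub_boxRigidity_var2340_of_statement`), so a refutation of the
variant would refute the Summit; no invariant of the four moves beyond `eval` is known.
Source: M. Kontsevich, D. Zagier, *Periods* (2001), §1.2 Conjecture 1; A. Baker, *Transcendental
Number Theory* (1975), Thm. 2.1. Pure proof file, no definitions. -/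

-- `Summit.<Summit>.<Problem>` is the tree's mandated summit-side namespace (CONVENTIONS §2); for this
-- single-conjunct summit the two coincide, so the duplicate is deliberate.
set_option linter.dupNamespace false

noncomputable section

namespace Summit.KontsevichZagierPeriods.KontsevichZagierPeriods.Theorems

open MeasureTheory Set
open Literature.NumberTheory.Transcendental Literature.NumberTheory.Transcendental.KZ
open Summit.KontsevichZagierPeriods.KontsevichZagierPeriods.Theses.HurwitzMicroSectors
open Summit.KontsevichZagierPeriods.HurwitzMicroSectors.NormalFormPrinciple.PiBox
open Summit.KontsevichZagierPeriods.HurwitzMicroSectors.NormalFormPrinciple.PiBox.stub_boxCombineAux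
  (pad_le sub_same)

/-! ## Jointly bounded dimensions: `BoxRigidity(m ≤ j, m' ≤ k) ⟺ BoxVanishing(dim ≤ max j k)` -/

/-- **`BoxRigidity(m ≤ j, m' ≤ k) ⇒ BoxVanishing(dim ≤ max j k)`**: a box-rational representation of
dimension `m ≤ max j k` and value `0` is a relation — compare it with the zero representation on the
`0`-box (box-rational, value `0`, itself a relation), placed on whichever side leaves room for `m`.
[cite: KontsevichZagier2001, §1.2 Conjecture 1] -/
theorem boxVanishingLe_of_boxRigidityLe (j k : ℕ)
    (hrig : ∀ (m m' : ℕ) (N : IntegralRep m) (N' : IntegralRep m'), m ≤ j → m' ≤ k →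
      N.domain = {x | ∀ i, x i ∈ Set.Ioo (0:ℝ) 1} → N.IsRational →
      N'.domain = {x | ∀ i, x i ∈ Set.Ioo (0:ℝ) 1} → N'.IsRational →
      N.value = N'.value → Equivalent N N') :
    ∀ (m : ℕ) (N : IntegralRep m), m ≤ max j k → N.domain = {x | ∀ i, x i ∈ Set.Ioo (0:ℝ) 1} →
      N.IsRational → N.value = 0 → of N ∈ relations := by
  intro m N hm hNd hNr hv
  obtain ⟨Z, hZd, hZi⟩ := exists_zeroRep (isSemialgebraic_box 0)
  have hZ : of Z ∈ relations := of_mem_relations_of_eqOn_zero Z (by simp [hZi, EqOn])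
  have hZv : Z.value = 0 := by simp [IntegralRep.value, hZi]
  have hZr : Z.IsRational := ⟨0, 1, fun x _ => by simp, fun x _ => by simp [hZi]⟩
  rcases le_max_iff.1 hm with hmj | hmk
  · have h : of N - of Z ∈ relations :=
      hrig m 0 N Z hmj (Nat.zero_le k) hNd hNr hZd hZr (by rw [hv, hZv])
    have := relations.add_mem h hZ
    rwa [sub_add_cancel] at this
  · have h : of Z - of N ∈ relations :=
      hrig 0 m Z N (Nat.zero_le j) hmk hZd hZr hNd hNr (by rw [hv, hZv])
    have := relations.sub_mem hZ h
    rwa [sub_sub_cancel] at this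

/-- **`BoxVanishing(dim ≤ K) ⇒ BoxRigidity(m ≤ j, m' ≤ k)` whenever `max j k ≤ K`**: pad both
representations by unit intervals to the common dimension `max m m' ≤ K` (`pad_le`: one Newton–Leibniz
move and two null faces per step), subtract the integrands on the common box (`sub_same`, rule 1b));
the difference is box-rational of value `0` by soundness, hence a relation.
[cite: KontsevichZagier2001, §1.2 Conjecture 1] -/
theorem boxRigidityLe_of_boxVanishingLe (j k K : ℕ) (hK : max j k ≤ K)
    (hvan : ∀ (m : ℕ) (N : IntegralRep m), m ≤ K → N.domain = {x | ∀ i, x i ∈ Set.Ioo (0:ℝ) 1} →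
      N.IsRational → N.value = 0 → of N ∈ relations) :
    ∀ (m m' : ℕ) (N : IntegralRep m) (N' : IntegralRep m'), m ≤ j → m' ≤ k →
      N.domain = {x | ∀ i, x i ∈ Set.Ioo (0:ℝ) 1} → N.IsRational →
      N'.domain = {x | ∀ i, x i ∈ Set.Ioo (0:ℝ) 1} → N'.IsRational →
      N.value = N'.value → Equivalent N N' := by
  intro m m' N N' hm hm' hNd hNr hN'd hN'r hv
  obtain ⟨R₁, h₁d, h₁r, h₁⟩ := pad_le (le_max_left m m') N hNd hNr
  obtain ⟨R₂, h₂d, h₂r, h₂⟩ := pad_le (le_max_right m m') N' hN'd hN'r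
  obtain ⟨M, hMd, hMr, hM⟩ := sub_same R₁ R₂ h₁d h₁r h₂d h₂r
  have hNM : of N - of N' - of M ∈ relations := by
    have e : of N - of N' - of M = (of N - of R₁) - (of N' - of R₂) + (of R₁ - of R₂ - of M) := by
      abel
    rw [e]
    exact relations.add_mem (relations.sub_mem h₁ h₂) hM
  have hMv : M.value = 0 := by
    have e := relations_le_ker_eval_holds hNM
    rw [AddMonoidHom.mem_ker, map_sub, map_sub, eval_of, eval_of, eval_of, hv, sub_self,
      zero_sub, neg_eq_zero] at e
    exact e
  have := relations.add_mem hNM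
    (hvan (max m m') M (le_trans (max_le_max hm hm') hK) hMd hMr hMv)
  rwa [sub_add_cancel] at this

/-- **`BoxRigidity(m ≤ j, m' ≤ k) ⟺ BoxVanishing(dim ≤ max j k)`**: a joint dimension bound on the
leaf `stub_boxRigidity` is worth exactly the vanishing statement up to the larger bound (so it depends
on `max j k` only). [cite: KontsevichZagier2001, §1.2 Conjecture 1] -/
theorem boxRigidityLe_iff_boxVanishingLe (j k : ℕ) :
    (∀ (m m' : ℕ) (N : IntegralRep m) (N' : IntegralRep m'), m ≤ j → m' ≤ k →
      N.domain = {x | ∀ i, x i ∈ Set.Ioo (0:ℝ) 1} → N.IsRational →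
      N'.domain = {x | ∀ i, x i ∈ Set.Ioo (0:ℝ) 1} → N'.IsRational →
      N.value = N'.value → Equivalent N N') ↔
    (∀ (m : ℕ) (N : IntegralRep m), m ≤ max j k → N.domain = {x | ∀ i, x i ∈ Set.Ioo (0:ℝ) 1} →
      N.IsRational → N.value = 0 → of N ∈ relations) :=
  ⟨boxVanishingLe_of_boxRigidityLe j k, boxRigidityLe_of_boxVanishingLe j k (max j k) le_rfl⟩

/-- **The jointly bounded leaf is symmetric and depends on `max j k` only**:
`BoxRigidity(m ≤ j, m' ≤ k) ⟺ BoxRigidity(m, m' ≤ max j k)`. [cite: KontsevichZagier2001, §1.2 Conjecture 1] -/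
theorem boxRigidityLe_iff_max (j k : ℕ) :
    (∀ (m m' : ℕ) (N : IntegralRep m) (N' : IntegralRep m'), m ≤ j → m' ≤ k →
      N.domain = {x | ∀ i, x i ∈ Set.Ioo (0:ℝ) 1} → N.IsRational →
      N'.domain = {x | ∀ i, x i ∈ Set.Ioo (0:ℝ) 1} → N'.IsRational →
      N.value = N'.value → Equivalent N N') ↔
    (∀ (m m' : ℕ) (N : IntegralRep m) (N' : IntegralRep m'), m ≤ max j k → m' ≤ max j k →
      N.domain = {x | ∀ i, x i ∈ Set.Ioo (0:ℝ) 1} → N.IsRational →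
      N'.domain = {x | ∀ i, x i ∈ Set.Ioo (0:ℝ) 1} → N'.IsRational →
      N.value = N'.value → Equivalent N N') := by
  rw [boxRigidityLe_iff_boxVanishingLe, boxRigidityLe_iff_boxVanishingLe, max_self]

/-! ## The proved frontier: `BoxVanishing(dim ≤ 1)` (Baker) -/

/-- **`BoxVanishing(dim ≤ 1)` holds**: a representation on `(0,1)^m`, `m ≤ 1`, with integrand of KZ's
rational shape and value `0` is a relation (`boxRigidity_of_le_one`, Baker's theorem on linear forms in
logarithms, through `boxVanishingLe_of_boxRigidityLe 1 1`). [cite: KontsevichZagier2001, §1.2 Conjecture 1] -/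
theorem boxVanishingLe_one :
    ∀ (m : ℕ) (N : IntegralRep m), m ≤ 1 → N.domain = {x | ∀ i, x i ∈ Set.Ioo (0:ℝ) 1} →
      N.IsRational → N.value = 0 → of N ∈ relations := by
  have h := boxVanishingLe_of_boxRigidityLe 1 1 fun m m' N N' hm hm' =>
    Dlog.boxRigidity_of_le_one m m' hm hm' N N'
  rwa [max_self] at h

/-- **Every two-sided variant with `max j k ≤ 1` is a theorem** (`BoxRigidity(m ≤ j, m' ≤ k)` for
`j, k ≤ 1`, from `boxVanishingLe_one`). [cite: KontsevichZagier2001, §1.2 Conjecture 1] -/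
theorem boxRigidityLe_of_max_le_one (j k : ℕ) (hjk : max j k ≤ 1) :
    ∀ (m m' : ℕ) (N : IntegralRep m) (N' : IntegralRep m'), m ≤ j → m' ≤ k →
      N.domain = {x | ∀ i, x i ∈ Set.Ioo (0:ℝ) 1} → N.IsRational →
      N'.domain = {x | ∀ i, x i ∈ Set.Ioo (0:ℝ) 1} → N'.IsRational →
      N.value = N'.value → Equivalent N N' :=
  boxRigidityLe_of_boxVanishingLe j k 1 hjk boxVanishingLe_one

/-! ## The variant V2340 itself -/

/-- **V2340 ⟺ BoxVanishing(dim ≤ 3)** (instance `j = 3, k = 2` of `boxRigidityLe_iff_boxVanishingLe`):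
the variant is exactly "every rational function over `ℚ` on `(0,1)^m`, `m ≤ 3`, absolutely integrable
with integral `0`, is a KZ relation" — Conjecture 1 for all box-rational periods of dimension `≤ 3`,
open. [cite: KontsevichZagier2001, §1.2 Conjecture 1] -/
theorem stub_boxRigidity_var2340_iff_boxVanishingLe :
    (∀ (m m' : ℕ) (N : IntegralRep m) (N' : IntegralRep m'), m ≤ 3 → m' ≤ 2 → N.domain = {x | ∀ i, x i ∈ Set.Ioo (0:ℝ) 1} → N.IsRational → N'.domain = {x | ∀ i, x i ∈ Set.Ioo (0:ℝ) 1} → N'.IsRational → N.value = N'.value → Equivalent N N') ↔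
    (∀ (m : ℕ) (N : IntegralRep m), m ≤ 3 → N.domain = {x | ∀ i, x i ∈ Set.Ioo (0:ℝ) 1} →
      N.IsRational → N.value = 0 → of N ∈ relations) :=
  boxRigidityLe_iff_boxVanishingLe 3 2

/-- **V2340 ⟺ BoxRigidity(m, m' ≤ 3)**: the bound `m' ≤ 2` is idle next to `m ≤ 3` (instance of
`boxRigidityLe_iff_max`). [cite: KontsevichZagier2001, §1.2 Conjecture 1] -/
theorem stub_boxRigidity_var2340_iff_le_three :
    (∀ (m m' : ℕ) (N : IntegralRep m) (N' : IntegralRep m'), m ≤ 3 → m' ≤ 2 → N.domain = {x | ∀ i, x i ∈ Set.Ioo (0:ℝ) 1} → N.IsRational → N'.domain = {x | ∀ i, x i ∈ Set.Ioo (0:ℝ) 1} → N'.IsRational → N.value = N'.value → Equivalent N N') ↔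
    (∀ (m m' : ℕ) (N : IntegralRep m) (N' : IntegralRep m'), m ≤ 3 → m' ≤ 3 →
      N.domain = {x | ∀ i, x i ∈ Set.Ioo (0:ℝ) 1} → N.IsRational →
      N'.domain = {x | ∀ i, x i ∈ Set.Ioo (0:ℝ) 1} → N'.IsRational →
      N.value = N'.value → Equivalent N N') :=
  boxRigidityLe_iff_max 3 2

/-- **`KontsevichZagierPeriods ⇒ V2340`**: the variant is a special case of Conjecture 1 for the
tree's calculus (`leaves_of_statement`) — a refutation of the variant would refute the Summit.
[cite: KontsevichZagier2001, §1.2 Conjecture 1] -/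
theorem stub_boxRigidity_var2340_of_statement (h : _root_.KontsevichZagierPeriods) :
    ∀ (m m' : ℕ) (N : IntegralRep m) (N' : IntegralRep m'), m ≤ 3 → m' ≤ 2 → N.domain = {x | ∀ i, x i ∈ Set.Ioo (0:ℝ) 1} → N.IsRational → N'.domain = {x | ∀ i, x i ∈ Set.Ioo (0:ℝ) 1} → N'.IsRational → N.value = N'.value → Equivalent N N' :=
  fun m m' N N' _ _ => (leaves_of_statement h).1 m m' N N'

/-- **The parent leaf ⇒ V2340** (specialisation), and the parent is the conjunction of ALL the
dimension-bounded vanishing statements: `BoxRigidity ⟺ ∀ K, BoxVanishing(dim ≤ K)`; V2340 is its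
rung `K = 3`. [cite: KontsevichZagier2001, §1.2 Conjecture 1] -/
theorem boxRigidity_iff_forall_boxVanishingLe :
    (∀ (m m' : ℕ) (N : IntegralRep m) (N' : IntegralRep m'),
      N.domain = {x | ∀ i, x i ∈ Set.Ioo (0:ℝ) 1} → N.IsRational →
      N'.domain = {x | ∀ i, x i ∈ Set.Ioo (0:ℝ) 1} → N'.IsRational →
      N.value = N'.value → Equivalent N N') ↔
    ∀ (K m : ℕ) (N : IntegralRep m), m ≤ K → N.domain = {x | ∀ i, x i ∈ Set.Ioo (0:ℝ) 1} →
      N.IsRational → N.value = 0 → of N ∈ relations :=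
  ⟨fun h _ _ N _ hNd hNr hv => boxVanishing_of_boxRigidity h N hNd hNr hv,
    fun h => boxRigidity_of_boxVanishing fun m N hNd hNr hv => h m m N le_rfl hNd hNr hv⟩

end Summit.KontsevichZagierPeriods.KontsevichZagierPeriods.Theorems
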